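import Summits.Ventures.CertifiedArithmetic.LowPrec.GemmThetaLawGenE3M2Data

/-!
# E3M2×E3M2 law check, part 10/11: `bin 14`, `bin 15`, `bin 16`

HONEST FRAMING (venture CertifiedArithmetic / cell `pub-lowprec`, seat gemm, gen 13): certified
error envelopes and provably optimal rounding/accumulation schemes for low-precision formats under
stated cost models; every table by two implementations; no hardware or vendor claims.

Part 10/11 of the per-level kernel check of `e3m2Law.lawCheck` (see
`GemmThetaLawGenE3M2Data.lean`): `bin 14`, `bin 15`, `bin 16` (1602 + 1518 + 1470 classes). [cell]
-/

namespace Literature.ComputerArithmetic.FloatingPoint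

namespace MiniFloat

namespace ThetaLaw

/-- Level `bin 14` of the E3M2×E3M2 law check passes (1602 classes, both signs, all 291 letters).
[cell, kernel `decide`] -/
theorem levCheck_e3m2_b14 : e3m2Law.levCheck (Lev.bin 14) = true := by
  decide +kernel

/-- Level `bin 15` of the E3M2×E3M2 law check passes (1518 classes, both signs, all 291 letters).
[cell, kernel `decide`] -/
theorem levCheck_e3m2_b15 : e3m2Law.levCheck (Lev.bin 15) = true := by
  decide +kernel

/-- Level `bin 16` of the E3M2×E3M2 law check passes (1470 classes, both signs, all 291 letters).
[cell, kernel `decide`] -/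
theorem levCheck_e3m2_b16 : e3m2Law.levCheck (Lev.bin 16) = true := by
  decide +kernel

end ThetaLaw

end MiniFloat

end Literature.ComputerArithmetic.FloatingPoint
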